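import Summits.HubbardSuperconductivity.HubbardSuperconductivity.Theorems.AnisotropyChordTransferFibre3RingResolvent
import Summits.HubbardSuperconductivity.HubbardSuperconductivity.Theorems.AnisotropyChordTransferFibre3ZeroRow

/-!
# Route `AnisotropyChord` / H0 rotor rung: PartN39 — the ROW DECOMPOSITION of the torus potential kernel at `λ = 0`, PROVED

PORT PartN39 (`…Fibre3RateLemma`, theory seat `hubbard-h0-rotor-theory-1` g21, memo 21 §322(a)) types
`RateLemma.RowDecompositionZero L`:
`a_L(x,y;0) = (1/L)[ y(L−y)/(2L) + Σ_{p=1}^{L−1} (R_L(p;0) − cos(2πpx/L) R_L(p;y)) ]` for `0 ≤ y ≤ L`.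
This file proves it (`rowDecompositionZero_holds`): unfold `aKer = G̃(0) − G̃(r)` into the double momentum sum
`(1/V) Σ_{(p,q)≠0} (1 − cos θ(px+qy))/(2ε(p,q))`, read the `p = 0` row as the zero-row sum (`ZeroRowIdentity`:
`y(L−y)/2`) and every `p ≠ 0` row, after `cos(A+B) = cos A cos B − sin A sin B` and the vanishing of the odd `sin` sum,
as `½[S_p(0) − cos(θpx) S_p(y)]` with the RING RESOLVENT SUM `S_p(y) = L cosh((L/2−y)μ_p)/(sinh μ_p sinh(Lμ_p/2))`
(`ringResolventSum_holds` of `…Fibre3RingResolvent`, prover `hubbard-h0-rotor-p3`; `cosh μ_p = 2 − cos θp`), i.e.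
`L(R_L(p;0) − cos(θpx)R_L(p;y))`.
Prover seat `hubbard-h0-rotor-p2` g0; helper for stmt-HubbardSuperconductivity-19089 (`--supports`, helper class).
WHAT THIS IS NOT: nothing here proves superconductivity in the Hubbard model; helper identity of ONE conditional reduction
(rung 19089, HOLE₂(.75) near-pair tail, periodisation at `λ = 0`).  Mathlib + tree imports only; no sorry, no axioms.
-/

set_option linter.dupNamespace false

noncomputable section

namespace Summit.HubbardSuperconductivity.HubbardSuperconductivity.Theorems.AnisotropyChord.Transfer.Fibre3

namespace RateLemma

open Real Finset

variable (L : ℕ) [NeZero L]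

omit [NeZero L] in
/-- the real part of the fibre character: `Re e^{iK·r} = cos(2π(K₁r₁ + K₂r₂)/L)` (values read through `val`). -/
theorem phase_re (k r : Tor L) :
    (phase L k r).re = Real.cos (2 * Real.pi * ((k.1.val * r.1.val + k.2.val * r.2.val : ℕ) : ℝ) / L) := by
  unfold phase
  rw [← Complex.exp_ofReal_mul_I_re]
  congr 1
  push_cast
  ring

/-- a `ZMod L`-indexed sum of a function of `val` is a `range L` sum. -/
theorem sum_zmod_val (f : ℕ → ℝ) : ∑ n : ZMod L, f n.val = ∑ k ∈ Finset.range L, f k := by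
  obtain ⟨n, hn⟩ : ∃ n : ℕ, L = n + 1 := ⟨L - 1, by have := NeZero.ne L; omega⟩
  subst hn
  rw [← Fin.sum_univ_eq_sum_range]
  rfl

/-- the ring resolvent sum at a natural height `y ≤ L`, as a `range` sum (from `ringResolventSum_holds`). -/
theorem ring_sum_nat (μ : ℝ) (hμ : 0 < μ) (y : ℕ) (hy : y ≤ L) :
    (∑ k ∈ Finset.range L, Real.cos (2 * Real.pi * k * y / L) / (Real.cosh μ - Real.cos (2 * Real.pi * k / L)))
      = L * Real.cosh (((L : ℝ) / 2 - y) * μ) / (Real.sinh μ * Real.sinh (L * μ / 2)) := by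
  have hL0 : L ≠ 0 := NeZero.ne L
  have hLr : (L : ℝ) ≠ 0 := by exact_mod_cast hL0
  have h := ringResolventSum_holds L μ hμ (y : ZMod L)
  rw [ZMod.val_natCast] at h
  rw [sum_zmod_val L (fun k => Real.cos (2 * Real.pi * k * ((y % L : ℕ) : ℝ) / L)
      / (Real.cosh μ - Real.cos (2 * Real.pi * k / L)))] at h
  rcases lt_or_eq_of_le hy with hlt | heq
  · rw [Nat.mod_eq_of_lt hlt] at h
    exact h
  · rw [heq] at h ⊢
    rw [Nat.mod_self] at h
    have e1 : ∀ k : ℕ, Real.cos (2 * Real.pi * k * ((L : ℕ) : ℝ) / L) = Real.cos (2 * Real.pi * k * ((0 : ℕ) : ℝ) / L) := by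
      intro k
      rw [show 2 * Real.pi * k * ((L : ℕ) : ℝ) / L = 2 * Real.pi * k * ((0 : ℕ) : ℝ) / L + (k : ℤ) * (2 * Real.pi) by
        push_cast; field_simp; ring, Real.cos_add_int_mul_two_pi]
    have e2 : Real.cosh (((L : ℝ) / 2 - ((L : ℕ) : ℝ)) * μ) = Real.cosh (((L : ℝ) / 2 - ((0 : ℕ) : ℝ)) * μ) := by
      rw [show ((L : ℝ) / 2 - ((L : ℕ) : ℝ)) * μ = -(((L : ℝ) / 2 - ((0 : ℕ) : ℝ)) * μ) by push_cast; ring, Real.cosh_neg]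
    simp only [e1, e2]
    exact h

omit [NeZero L] in
/-- the odd sum vanishes: `Σ_{k=0}^{L−1} sin(2πky/L)/(c − cos(2πk/L)) = 0` (integer `y`). -/
theorem sum_sin_div_eq_zero (c : ℝ) (y : ℕ) :
    ∑ k ∈ Finset.range L, Real.sin (2 * Real.pi * k * y / L) / (c - Real.cos (2 * Real.pi * k / L)) = 0 := by
  rcases Nat.eq_zero_or_pos L with hL | hL
  · subst hL; simp
  have hLr : (L : ℝ) ≠ 0 := by exact_mod_cast hL.ne'
  have h0 : (0 : ℕ) ∈ Finset.range L := by simp; omega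
  rw [← Finset.sum_erase_add _ _ h0]
  simp only [Nat.cast_zero, mul_zero, zero_mul, zero_div, Real.sin_zero, add_zero]
  set s := (Finset.range L).erase 0 with hs
  set f : ℕ → ℝ := fun k => Real.sin (2 * Real.pi * k * y / L) / (c - Real.cos (2 * Real.pi * k / L)) with hf
  -- the involution k ↦ L − k reverses the sign
  have hmem : ∀ k ∈ s, L - k ∈ s := by
    intro k hk
    rw [hs, Finset.mem_erase, Finset.mem_range] at hk ⊢
    omega
  have hinv : ∀ k ∈ s, L - (L - k) = k := by
    intro k hk
    rw [hs, Finset.mem_erase, Finset.mem_range] at hk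
    omega
  have hodd : ∀ k ∈ s, f k = -f (L - k) := by
    intro k hk
    rw [hs, Finset.mem_erase, Finset.mem_range] at hk
    have hkL : k ≤ L := hk.2.le
    simp only [hf]
    rw [Nat.cast_sub hkL]
    have e1 : 2 * Real.pi * ((L : ℝ) - k) * y / L = -(2 * Real.pi * k * y / L) + ((y : ℕ) : ℤ) * (2 * Real.pi) := by
      push_cast; field_simp; ring
    have e2 : 2 * Real.pi * ((L : ℝ) - k) / L = -(2 * Real.pi * k / L) + ((1 : ℕ) : ℤ) * (2 * Real.pi) := by
      push_cast; field_simp; ring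
    rw [e1, e2, Real.sin_add_int_mul_two_pi, Real.cos_add_int_mul_two_pi, Real.sin_neg, Real.cos_neg]
    ring
  have hsum : ∑ k ∈ s, f k = ∑ k ∈ s, -f k := by
    calc ∑ k ∈ s, f k = ∑ k ∈ s, -f (L - k) := Finset.sum_congr rfl hodd
      _ = ∑ k ∈ s, -f k :=
        Finset.sum_nbij' (fun k => L - k) (fun k => L - k) hmem hmem hinv hinv (fun k _ => rfl)
  rw [Finset.sum_neg_distrib] at hsum
  show ∑ k ∈ s, f k = 0
  linarith

omit [NeZero L] in
/-- `μ_p = arcosh(2 − cos(2πp/L))`, hence `cosh μ_p = 2 − cos(2πp/L)` and `μ_p > 0` for `0 < p < L`. -/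
theorem rowMu_eq_arcosh (p : ℕ) : rowMu L p = Real.arcosh (2 - Real.cos (2 * Real.pi * p / L)) := rfl

omit [NeZero L] in
/-- `cosh μ_p = 2 − cos(2πp/L)`. -/
theorem cosh_rowMu (p : ℕ) : Real.cosh (rowMu L p) = 2 - Real.cos (2 * Real.pi * p / L) := by
  rw [rowMu_eq_arcosh]
  exact Real.cosh_arcosh (by linarith [Real.cos_le_one (2 * Real.pi * p / L)])

omit [NeZero L] in
/-- `μ_p > 0` for `0 < p < L`. -/
theorem rowMu_pos (p : ℕ) (hp : 0 < p) (hpL : p < L) : 0 < rowMu L p := by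
  rw [rowMu_eq_arcosh]
  apply Real.arcosh_pos
  have := cos_ne_one L p hp hpL
  have := Real.cos_le_one (2 * Real.pi * p / L)
  have : Real.cos (2 * Real.pi * p / L) < 1 := lt_of_le_of_ne ‹_› ‹_›
  linarith

/-- one `p ≠ 0` row: `Σ_{q=0}^{L−1} (1 − cos θ(px+qy))/(2(2 − cos θp − cos θq)) = L (R(p;0) − cos(θpx) R(p;y))`
for `0 < p < L`, `0 ≤ y ≤ L`. -/
theorem row_sum (p : ℕ) (hp : 0 < p) (hpL : p < L) (x y : ℕ) (hy : y ≤ L) :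
    (∑ q ∈ Finset.range L, (1 - Real.cos (2 * Real.pi * ((p * x + q * y : ℕ) : ℝ) / L))
        / (2 * (2 - Real.cos (2 * Real.pi * p / L) - Real.cos (2 * Real.pi * q / L))))
      = L * (ringR L p 0 - Real.cos (2 * Real.pi * p * x / L) * ringR L p y) := by
  have hL : L ≠ 0 := by omega
  set μ := rowMu L p with hμdef
  have hμ : 0 < μ := rowMu_pos L p hp hpL
  have hc : Real.cosh μ = 2 - Real.cos (2 * Real.pi * p / L) := cosh_rowMu L p
  set A : ℝ := 2 * Real.pi * p * x / L with hA
  -- termwise expansion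
  have hterm : ∀ q ∈ Finset.range L,
      (1 - Real.cos (2 * Real.pi * ((p * x + q * y : ℕ) : ℝ) / L))
        / (2 * (2 - Real.cos (2 * Real.pi * p / L) - Real.cos (2 * Real.pi * q / L)))
      = (1 / 2) * (1 / (Real.cosh μ - Real.cos (2 * Real.pi * q / L)))
        - (1 / 2) * Real.cos A * (Real.cos (2 * Real.pi * q * y / L) / (Real.cosh μ - Real.cos (2 * Real.pi * q / L)))
        + (1 / 2) * Real.sin A * (Real.sin (2 * Real.pi * q * y / L) / (Real.cosh μ - Real.cos (2 * Real.pi * q / L))) := by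
    intro q _
    rw [hc]
    have e : 2 * Real.pi * ((p * x + q * y : ℕ) : ℝ) / L = A + 2 * Real.pi * q * y / L := by
      rw [hA]; push_cast; ring
    rw [e, Real.cos_add]
    have hden : 2 - Real.cos (2 * Real.pi * p / L) - Real.cos (2 * Real.pi * q / L) ≠ 0 := by
      have h1 := cos_ne_one L p hp hpL
      have h2 := Real.cos_le_one (2 * Real.pi * p / L)
      have h3 := Real.cos_le_one (2 * Real.pi * q / L)
      have : Real.cos (2 * Real.pi * p / L) < 1 := lt_of_le_of_ne h2 h1
      intro h; linarith
    field_simp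
    ring
  rw [Finset.sum_congr rfl hterm, Finset.sum_add_distrib, Finset.sum_sub_distrib, ← Finset.mul_sum, ← Finset.mul_sum,
    ← Finset.mul_sum, sum_sin_div_eq_zero L (Real.cosh μ) y, mul_zero, add_zero]
  -- the two ring resolvent sums
  have hS0 := ring_sum_nat L μ hμ 0 (Nat.zero_le _)
  have hSy := ring_sum_nat L μ hμ y hy
  simp only [Nat.cast_zero, mul_zero, zero_div, Real.cos_zero, sub_zero] at hS0
  have e0 : (∑ k ∈ Finset.range L, 1 / (Real.cosh μ - Real.cos (2 * Real.pi * k / L)))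
      = L * Real.cosh ((L : ℝ) / 2 * μ) / (Real.sinh μ * Real.sinh (L * μ / 2)) := hS0
  rw [e0, hSy]
  unfold ringR
  rw [← hμdef]
  ring

/-- ★ `RowDecompositionZero` holds. -/
theorem rowDecompositionZero_holds : RowDecompositionZero L := by
  intro x y hy
  have hL : L ≠ 0 := NeZero.ne L
  have hL1 : 1 ≤ L := Nat.pos_of_ne_zero hL
  have hLr : (L : ℝ) ≠ 0 := by exact_mod_cast hL
  -- `cos(2πn/L)` only depends on `n mod L` (also `…SeamGluingLocality.Negative.cos_two_pi_mul_mod`; kept local to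
  -- avoid importing an unrelated module)
  have cos_mod_eq : ∀ n : ℕ,
      Real.cos (2 * Real.pi * ((n % L : ℕ) : ℝ) / L) = Real.cos (2 * Real.pi * (n : ℝ) / L) := by
    intro n
    conv_rhs => rw [← Nat.mod_add_div n L]
    rw [show 2 * Real.pi * (((n % L + L * (n / L) : ℕ)) : ℝ) / L
        = 2 * Real.pi * ((n % L : ℕ) : ℝ) / L + ((n / L : ℕ) : ℕ) * (2 * Real.pi) by push_cast; field_simp]
    rw [Real.cos_add_nat_mul_two_pi]
  -- Step 1: aKer as a single momentum sum of real terms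
  have hx : ((x : ZMod L)).val = x % L := ZMod.val_natCast _ _
  have hyv : ((y : ZMod L)).val = y % L := ZMod.val_natCast _ _
  set F : ℕ → ℕ → ℝ := fun p q =>
    if p = 0 ∧ q = 0 then 0 else
      (1 - Real.cos (2 * Real.pi * ((p * x + q * y : ℕ) : ℝ) / L))
        / (2 * (2 - Real.cos (2 * Real.pi * p / L) - Real.cos (2 * Real.pi * q / L))) with hF
  have hk : ∀ k : Tor L, gres L 0 k * (phase L k 0).re - gres L 0 k * (phase L k (((x : ZMod L)), ((y : ZMod L)))).re
      = F k.1.val k.2.val := by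
    intro k
    rw [phase_re, phase_re]
    simp only [hF, gres, epsT]
    by_cases h0 : k = 0
    · subst h0
      simp
    · have hne : ¬ (k.1.val = 0 ∧ k.2.val = 0) := by
        intro h
        apply h0
        ext <;> simp [ZMod.val_eq_zero] at h ⊢ <;> tauto
      rw [if_neg h0, if_neg hne]
      have e1 : Real.cos (2 * Real.pi * ((k.1.val * ((0 : Tor L)).1.val + k.2.val * ((0 : Tor L)).2.val : ℕ) : ℝ) / L) = 1 := by
        simp
      rw [e1, hx, hyv]
      have e2 : Real.cos (2 * Real.pi * ((k.1.val * (x % L) + k.2.val * (y % L) : ℕ) : ℝ) / L)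
          = Real.cos (2 * Real.pi * ((k.1.val * x + k.2.val * y : ℕ) : ℝ) / L) := by
        rw [← cos_mod_eq (k.1.val * (x % L) + k.2.val * (y % L)), ← cos_mod_eq (k.1.val * x + k.2.val * y)]
        congr 3
        simp [Nat.add_mod, Nat.mul_mod]
      rw [e2, sub_zero]
      field_simp
  have haKer : aKer L 0 (((x : ZMod L)), ((y : ZMod L)))
      = (∑ k : Tor L, F k.1.val k.2.val) / (L : ℝ) ^ 2 := by
    unfold aKer Gres
    rw [← sub_div, ← Finset.sum_sub_distrib]
    congr 1
    exact Finset.sum_congr rfl (fun k _ => hk k)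
  rw [haKer, Fintype.sum_prod_type]
  simp only []
  rw [show (∑ p : ZMod L, ∑ q : ZMod L, F p.val q.val) = ∑ p ∈ Finset.range L, ∑ q ∈ Finset.range L, F p q by
    rw [sum_zmod_val L (fun p => ∑ q ∈ Finset.range L, F p q) |>.symm]
    refine Finset.sum_congr rfl (fun p _ => ?_)
    exact sum_zmod_val L (fun q => F p.val q)]
  -- Step 2: split off the row p = 0
  have h0 : (0 : ℕ) ∈ Finset.range L := by simp; omega
  rw [← Finset.sum_erase_add _ _ h0]
  -- the zero row
  have hrow0 : (∑ q ∈ Finset.range L, F 0 q) = zeroRow L y := by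
    rw [← Finset.sum_erase_add _ _ h0]
    have : F 0 0 = 0 := by simp [hF]
    rw [this, add_zero]
    unfold zeroRow
    refine Finset.sum_congr rfl (fun q hq => ?_)
    rw [Finset.mem_erase] at hq
    have hq0 : ¬ (0 = 0 ∧ q = 0) := by omega
    simp only [hF, if_neg hq0]
    push_cast
    simp only [zero_mul, zero_add, mul_zero, zero_div, Real.cos_zero]
    rw [show (2 : ℝ) * (2 - 1 - Real.cos (2 * Real.pi * q / L)) = 2 - 2 * Real.cos (2 * Real.pi * q / L) by ring,
      show 2 * Real.pi * ((q : ℝ) * y) / L = 2 * Real.pi * q * y / L by ring]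
  -- the other rows
  have hrows : ∀ p ∈ (Finset.range L).erase 0,
      (∑ q ∈ Finset.range L, F p q) = L * (ringR L p 0 - Real.cos (2 * Real.pi * p * x / L) * ringR L p y) := by
    intro p hp
    rw [Finset.mem_erase, Finset.mem_range] at hp
    rw [← row_sum L p (Nat.pos_of_ne_zero hp.1) hp.2 x y hy]
    refine Finset.sum_congr rfl (fun q _ => ?_)
    have : ¬ (p = 0 ∧ q = 0) := by omega
    simp only [hF, if_neg this]
  rw [hrow0, Finset.sum_congr rfl hrows, zeroRow_eq L hL1 y hy, ← Finset.mul_sum]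
  generalize (∑ p ∈ (Finset.range L).erase 0,
    (ringR L p 0 - Real.cos (2 * Real.pi * p * x / L) * ringR L p y)) = R
  field_simp
  ring

end RateLemma

end Summit.HubbardSuperconductivity.HubbardSuperconductivity.Theorems.AnisotropyChord.Transfer.Fibre3

end
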